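import Summits.HodgeConjecture.CorCM.Census.TwistScrewLaw

/-!
# Uniform twist generation, XVI: TWO COLUMNS (`|B| = 2`), PREPARATIONS — exact centre distances, the two-column coincidences,
# the equatorial square IS the upper star, and the lowest transfer from the higher ones

COR-CM (cell `pub-hodgecm2`), count-neutral kernel combinatorics by the binder seat b09 (gen 37; lane UNIFORM TWIST GENERATION, part XVI), on
parts II–XV used BY NAME.  Theorems only: no definition, no `decide`, no certificate, no named fact, no `sorry`.
HONEST FRAMING: `HC_CM` is NOT proved, here or anywhere in the tree; nothing here is a period or a headline.

THE POINT.  Parts VIII–XV settle `μ(ℤ/2n × B, (n,0))` for `|B| ≥ 3`; `|B| = 1` (cyclic `G`) is seat b23ʼs `Census/CyclicFacesGenerate`.  The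
remaining complement `|B| = 2` (`G = ℤ/2n × ℤ/2`; fields: a cyclic CM field of degree `2n` times a real quadratic field) has ONE residual block
fewer (the atoms at the first and the last row of an arc coincide up to base change) and is repaired by TWO-COLUMN COINCIDENCES: with
`B = {b₁, b₂}`, lowering the centre `cst (a+1)` at the column `b₁` gives the canonical atom `catom a b₂` of the OTHER column.  Consequences
(this file): the equatorial square at `cst a` is LITERALLY `−wplus a` (§3), and the lowest interior transfer `trans a (a+1) b` is `−wplus (a+1)`
modulo pairs and the transfers of levels `2, …, n − 1` (§4, a DOWNWARD transfer chain to the centre `a + 2 − n`, whose arc ends at the row `a + 1`).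
§1: the exact distance between centres `|cst (a+d) ∖ cst a| = d·|B|` (`d ≤ n`); §2: the coincidences.  Part XVII (`Census/TwistTwoColumnLaw.lean`)
assembles the two-column law `μ = β − 1`.

## References
* [Pohlmann1968] H. Pohlmann, Algebraic cycles on abelian varieties of complex multiplication type, Ann. of Math. 88 (1968), Thm 1.
* [Milne1999] J. S. Milne, Lefschetz motives and the Tate conjecture, Compositio Math. 117 (1999), Prop. 2.1, p. 54.
-/

namespace Summit.HodgeConjecture.CorCM.Census.TwistGeneration

open Finset
open Summit.HodgeConjecture.CorCM.Prior.AllgGroup.RfwfAllgGroup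
open Summit.HodgeConjecture.CorCM.Census.BlockParity
open Summit.HodgeConjecture.CorCM.Census.Coinvariant

noncomputable section

variable {G : Type*} [Group G] [Fintype G] [DecidableEq G] {c : G}
variable {B : Type} [AddGroup B]
variable {n : ℕ} [NeZero n] (θ : G ≃ ZMod (2 * n) × B)
variable (hθ : ∀ P Q : G, θ (P * Q) = θ P + θ Q) (hθc : θ c = (((n : ℕ) : ZMod (2 * n)), 0))

/-! ## §1 Exact distances between centres -/

section Dist

variable [Fintype B]

/-- **The exact distance between centres**: for `d ≤ n`, `cst (a + d) ∖ cst a` consists of the rows `a + n, …, a + n + d − 1`, so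
`|cst (a + d) ∖ cst a| = d·|B|`. [folklore] -/
theorem card_sdiff_cst_add (a : ZMod (2 * n)) {d : ℕ} (hd : d ≤ n) :
    ((cst θ hθ hθc (a + (d : ℕ))).1 \ (cst θ hθ hθc a).1).card = d * Fintype.card B := by
  have h2n : n < 2 * n := by have := NeZero.ne n; omega
  have himg : (cst θ hθ hθc (a + (d : ℕ))).1 \ (cst θ hθ hθc a).1 =
      ((range d) ×ˢ (univ : Finset B)).image (fun ib : ℕ × B => θ.symm (a + ((n + ib.1 : ℕ) : ℕ), ib.2)) := by
    ext P
    rw [mem_sdiff, mem_cst, mem_cst, mem_image]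
    constructor
    · rintro ⟨h1, h2⟩
      -- `v = (θP).1 − a` has `v.val ≥ n` and `(v − d).val < n`, so `v.val = n + i` with `i < d`
      set v : ZMod (2 * n) := (θ P).1 - a with hv
      have hvlt := ZMod.val_lt v
      have h2' : n ≤ v.val := by omega
      have h1' : (v - (d : ℕ)).val < n := by
        rw [show v - ((d : ℕ) : ZMod (2 * n)) = (θ P).1 - (a + (d : ℕ)) by rw [hv]; ring]; exact h1
      have hdval : ((d : ℕ) : ZMod (2 * n)).val = d := ZMod.val_cast_of_lt (by omega)
      have h3 : (v - (d : ℕ)).val = v.val - d := by rw [ZMod.val_sub (by rw [hdval]; omega), hdval]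
      rw [h3] at h1'
      refine ⟨(v.val - n, (θ P).2), mem_product.mpr ⟨mem_range.mpr (by omega), mem_univ _⟩, ?_⟩
      show θ.symm (a + ((n + (v.val - n) : ℕ) : ZMod (2 * n)), (θ P).2) = P
      rw [show n + (v.val - n) = v.val by omega, ZMod.natCast_zmod_val, hv, add_sub_cancel, Prod.mk.eta, Equiv.symm_apply_apply]
    · rintro ⟨⟨i, b⟩, hib, rfl⟩
      have hi : i < d := mem_range.mp (mem_product.mp hib).1
      rw [Equiv.apply_symm_apply]
      refine ⟨?_, ?_⟩
      · show (a + ((n + i : ℕ) : ZMod (2 * n)) - (a + (d : ℕ))).val < n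
        rw [show a + ((n + i : ℕ) : ZMod (2 * n)) - (a + (d : ℕ)) = ((n + i : ℕ) : ZMod (2 * n)) - (d : ℕ) by ring,
          ← Nat.cast_sub (by omega), ZMod.val_cast_of_lt (by omega)]
        omega
      · show ¬ (a + ((n + i : ℕ) : ZMod (2 * n)) - a).val < n
        rw [add_sub_cancel_left, ZMod.val_cast_of_lt (by omega)]
        omega
  rw [himg, card_image_of_injOn, card_product, card_range, card_univ]
  rintro ⟨i, b⟩ hib ⟨i', b'⟩ hib' h
  have hi : i < d := mem_range.mp (mem_product.mp (mem_coe.mp hib)).1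
  have hi' : i' < d := mem_range.mp (mem_product.mp (mem_coe.mp hib')).1
  have h' := θ.symm.injective h
  simp only [Prod.mk.injEq, add_right_inj] at h'
  obtain ⟨h1, h2⟩ := h'
  have h3 := congrArg ZMod.val h1
  rw [ZMod.val_cast_of_lt (by omega), ZMod.val_cast_of_lt (by omega)] at h3
  rw [show i = i' by omega, h2]

/-- **Deviation distance is symmetric on CM types** (`x ↦ c·x` is a bijection `T ∖ Ψ → Ψ ∖ T`). [folklore] -/
theorem ddist_comm (hc2 : c * c = 1) (T Ψ : CMF G c) : ddist T Ψ = ddist Ψ T := by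
  unfold ddist
  have himg : Ψ.1 \ T.1 = (T.1 \ Ψ.1).image (fun x => c * x) := by
    ext y
    rw [mem_sdiff, mem_image]
    constructor
    · rintro ⟨hyΨ, hyT⟩
      refine ⟨c * y, mem_sdiff.mpr ⟨?_, (Ψ.2 y).mp hyΨ⟩, by rw [cmul_cmul c hc2]⟩
      by_contra h; exact hyT ((T.2 y).mpr h)
    · rintro ⟨x, hx, rfl⟩
      rw [mem_sdiff] at hx
      exact ⟨by by_contra h; exact hx.2 ((Ψ.2 x).mpr h), (T.2 x).mp hx.1⟩
  rw [himg, card_image_of_injective _ (mul_right_injective c)]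

/-- The distance between centres, upwards: `ddist (cst (a + d)) (cst a) = d·|B|` for `d ≤ n`. [folklore] -/
theorem ddist_cst_add_cst (a : ZMod (2 * n)) {d : ℕ} (hd : d ≤ n) :
    ddist (cst θ hθ hθc (a + (d : ℕ))) (cst θ hθ hθc a) = d * Fintype.card B :=
  card_sdiff_cst_add θ hθ hθc a hd

/-- **The distance between two centres** is `|B|` times their cyclic distance: if `(a' − a).val ≤ n` then
`ddist (cst a') (cst a) = (a' − a).val · |B|`. [folklore] -/
theorem ddist_cst_cst_of_val_le {a a' : ZMod (2 * n)} (h : (a' - a).val ≤ n) :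
    ddist (cst θ hθ hθc a') (cst θ hθ hθc a) = (a' - a).val * Fintype.card B := by
  have e : a' = a + (((a' - a).val : ℕ) : ZMod (2 * n)) := by rw [ZMod.natCast_zmod_val, add_sub_cancel]
  conv_lhs => rw [e]
  exact ddist_cst_add_cst θ hθ hθc a h

/-- … and if `(a − a').val ≤ n` then `ddist (cst a') (cst a) = (a − a').val · |B|` (symmetry). [folklore] -/
theorem ddist_cst_cst_of_val_le' (hc2 : c * c = 1) {a a' : ZMod (2 * n)} (h : (a - a').val ≤ n) :
    ddist (cst θ hθ hθc a') (cst θ hθ hθc a) = (a - a').val * Fintype.card B := by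
  rw [ddist_comm hc2, ddist_cst_cst_of_val_le θ hθ hθc h]

end Dist

/-! ## §2 The two-column coincidences -/

section TwoCol

omit [Fintype G] [NeZero n] in
include hθ hθc in
/-- Membership of `θ⁻¹(y, b)` in the place of `θ⁻¹(x, b')`. [folklore] -/
theorem symm_mem_orb_symm_iff (x y : ZMod (2 * n)) (b b' : B) :
    θ.symm (y, b) ∈ orb c (θ.symm (x, b')) ↔ b = b' ∧ (y = x ∨ y = x + n) := by
  rw [mem_orb, c_mul_symm θ hθ hθc, θ.symm.injective.eq_iff, θ.symm.injective.eq_iff, Prod.mk.injEq, Prod.mk.injEq]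
  tauto

variable {b₁ b₂ : B} (h12 : b₁ ≠ b₂) (huniv : ∀ b : B, b = b₁ ∨ b = b₂)

include hθ hθc h12 huniv in
/-- **THE TWO-COLUMN COINCIDENCE.**  With `B = {b₁, b₂}`: lowering the centre `cst (a + 1)` at the column `b₁` (the flip at the place of
`θ⁻¹(a, b₁)`) gives the canonical atom `catom a b₂` of the other column. [folklore] -/
theorem oflipCM_cst_succ_eq_catom (hc2 : c * c = 1) (a : ZMod (2 * n)) :
    oflipCM c hc2 (θ.symm (a, b₁)) (cst θ hθ hθc (a + 1)) = catom θ hθ hθc hc2 a b₂ := by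
  apply Subtype.ext; ext P
  obtain ⟨⟨y, b⟩, rfl⟩ := θ.symm.surjective P
  rw [catom, mem_oflipCM_iff' hc2, mem_oflipCM_iff' hc2, symm_mem_cst, symm_mem_cst, symm_mem_orb_symm_iff θ hθ hθc,
    symm_mem_orb_symm_iff θ hθ hθc]
  -- reduce to the arithmetic of `v = y − a`
  set v : ZMod (2 * n) := y - a with hv
  have hvlt := ZMod.val_lt v
  have e1 : y - (a + 1) = v - 1 := by rw [hv]; ring
  have k0 : y = a ↔ v.val = 0 := by rw [ZMod.val_eq_zero, hv, sub_eq_zero]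
  have kn : y = a + n ↔ v.val = n := by
    constructor
    · intro h; rw [hv, h, add_sub_cancel_left, val_n]
    · intro h
      have : v = (n : ℕ) := ZMod.val_injective _ (by rw [h, val_n])
      rw [hv, sub_eq_iff_eq_add'] at this; exact this
  rw [e1, val_sub_one_lt_iff, k0, kn]
  rcases huniv b with rfl | rfl
  · simp only [true_and, h12, false_and, iff_false, not_not]
    omega
  · simp only [h12.symm, false_and, iff_false, not_not, true_and]
    omega

include hθ hθc h12 huniv in
/-- Raising both columns of a centre gives the next centre: `(catom a b₂)^{(θ⁻¹(a, b₁))} = cst (a + 1)`. [folklore] -/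
theorem oflipCM_catom_eq_cst_succ (hc2 : c * c = 1) (a : ZMod (2 * n)) :
    oflipCM c hc2 (θ.symm (a, b₁)) (catom θ hθ hθc hc2 a b₂) = cst θ hθ hθc (a + 1) := by
  rw [← oflipCM_cst_succ_eq_catom θ hθ hθc h12 huniv hc2 a, oflipCM_oflipCM_self]

variable [Fintype B]

omit [AddGroup B] [NeZero n] in
include h12 huniv in
/-- Sums over a two-element column group. [folklore] -/
theorem sum_eq_add_of_two {M : Type*} [AddCommMonoid M] (f : B → M) : ∑ b : B, f b = f b₁ + f b₂ := by
  classical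
  have hu : (univ : Finset B) = {b₁, b₂} := by
    ext b; rw [mem_insert, mem_singleton]; exact iff_of_true (mem_univ b) (huniv b)
  rw [hu, sum_pair h12]

omit [AddGroup B] [NeZero n] in
include h12 huniv in
/-- A two-element column group has two elements. [folklore] -/
theorem card_eq_two_of_two : Fintype.card B = 2 := by
  classical
  have hu : (univ : Finset B) = {b₁, b₂} := by
    ext b; rw [mem_insert, mem_singleton]; exact iff_of_true (mem_univ b) (huniv b)
  rw [← card_univ, hu, card_pair h12]

/-! ## §3 The equatorial square is the upper star -/

include h12 huniv in
/-- **With two columns the equatorial square at a centre IS (minus) the upper star**: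
`gface (cst a) θ⁻¹(a, b₁) θ⁻¹(a, b₂) = −wplus a`. [folklore] -/
theorem gface_cst_eq_neg_wplus (hc2 : c * c = 1) (a : ZMod (2 * n)) :
    gface c hc2 (cst θ hθ hθc a) (θ.symm (a, b₁)) (θ.symm (a, b₂)) = - wplus θ hθ hθc hc2 a := by
  rw [gface, wplus, sum_eq_add_of_two h12 huniv, card_eq_two_of_two h12 huniv]
  change Finsupp.single (cst θ hθ hθc a) 1 + Finsupp.single (oflipCM c hc2 (θ.symm (a, b₁)) (catom θ hθ hθc hc2 a b₂)) 1
      - Finsupp.single (catom θ hθ hθc hc2 a b₁) 1 - Finsupp.single (catom θ hθ hθc hc2 a b₂) 1 = _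
  rw [oflipCM_catom_eq_cst_succ θ hθ hθc h12 huniv hc2 a]
  push_cast
  rw [one_smul]
  abel

/-! ## §4 The lowest transfer from the higher ones -/

omit [Fintype B] in
/-- **Downward transfer chain**: if `L` holds the transfers of levels `2, …, n − 1`, then for `m ≤ n − 2` the atom-minus-centre vectors of the place
`(a + 1, b)` at the centres `a` and `a − m` agree modulo `L`. [folklore] -/
theorem downward_chain_mem (hc2 : c * c = 1) (L : Submodule ℤ (CMF G c →₀ ℤ))
    (hT : ∀ (a x : ZMod (2 * n)) (b : B), 2 ≤ (x - a).val → (x - a).val < n → trans θ hθ hθc hc2 a x b ∈ L) (a : ZMod (2 * n)) (b : B) :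
    ∀ m : ℕ, m + 2 ≤ n →
      (Finsupp.single (oflipCM c hc2 (θ.symm (a + 1, b)) (cst θ hθ hθc a)) 1 - Finsupp.single (cst θ hθ hθc a) 1)
        - (Finsupp.single (oflipCM c hc2 (θ.symm (a + 1, b)) (cst θ hθ hθc (a - (m : ℕ)))) 1
            - Finsupp.single (cst θ hθ hθc (a - (m : ℕ))) 1) ∈ L := by
  intro m
  induction m with
  | zero => intro _; rw [Nat.cast_zero, sub_zero, sub_self]; exact Submodule.zero_mem _
  | succ m ih =>
    intro hm
    have h2n : m + 2 < 2 * n := by omega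
    have hlev : (a + 1 - (a - ((m + 1 : ℕ) : ℕ))).val = m + 2 := by
      rw [show a + 1 - (a - ((m + 1 : ℕ) : ℕ)) = ((m + 2 : ℕ) : ZMod (2 * n)) by push_cast; ring, ZMod.val_cast_of_lt h2n]
    have ht := hT (a - ((m + 1 : ℕ) : ℕ)) (a + 1) b (by rw [hlev]; omega) (by rw [hlev]; omega)
    have e1 : a - ((m + 1 : ℕ) : ℕ) + 1 = a - (m : ℕ) := by push_cast; ring
    rw [trans, e1] at ht
    have key := Submodule.sub_mem _ (ih (by omega)) ht
    convert key using 1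
    abel

include h12 huniv in
/-- **THE LOWEST TRANSFER IS THE UPPER STAR (two columns)**: if `ℤ⟨pairs⟩ ≤ L` and `L` holds the transfers of levels `2, …, n − 1`, then
`trans a (a+1) b₁ + wplus (a+1) ∈ L` — by the downward chain to the centre `a + 2 − n`, whose arc ENDS at the row `a + 1`, and the two-column
coincidence `cst (a+2−n)` lowered at `b₁` `= catom (a+1−n) b₂ ≡ −catom (a+1) b₂` modulo pairs. [folklore] -/
theorem trans_succ_add_wplus_mem (hc2 : c * c = 1) (hn : 2 ≤ n) (L : Submodule ℤ (CMF G c →₀ ℤ))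
    (hP : Submodule.span ℤ (pairSet c) ≤ L)
    (hT : ∀ (a x : ZMod (2 * n)) (b : B), 2 ≤ (x - a).val → (x - a).val < n → trans θ hθ hθc hc2 a x b ∈ L) (a : ZMod (2 * n)) :
    trans θ hθ hθc hc2 a (a + 1) b₁ + wplus θ hθ hθc hc2 (a + 1) ∈ L := by
  have hchain := downward_chain_mem θ hθ hθc hc2 L hT a b₁ (n - 2) (by omega)
  -- the far centre `a − (n−2) = a + 2 − n` lowered at `b₁` is `catom (a + 1 − n) b₂`
  have hfar : oflipCM c hc2 (θ.symm (a + 1, b₁)) (cst θ hθ hθc (a - ((n - 2 : ℕ) : ℕ))) = catom θ hθ hθc hc2 (a + 1 - n) b₂ := by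
    have e : a - ((n - 2 : ℕ) : ℕ) = (a + 1 - n) + 1 := by
      rw [Nat.cast_sub hn]; push_cast; ring
    rw [e, ← oflipCM_cst_succ_eq_catom θ hθ hθc h12 huniv hc2 (a + 1 - n), ← oflipCM_cmul c hc2 (θ.symm (a + 1 - n, b₁)),
      c_mul_symm θ hθ hθc, sub_add_cancel]
  rw [hfar] at hchain
  have hpa := single_catom_add_mem_span_pairSet θ hθ hθc hc2 (a + 1 - n) b₂
  have hpc := single_cst_add_mem_span_pairSet θ hθ hθc (a - ((n - 2 : ℕ) : ℕ))
  rw [sub_add_cancel] at hpa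
  have ec : a - ((n - 2 : ℕ) : ℕ) + n = a + 1 + 1 := by rw [Nat.cast_sub hn]; push_cast; ring
  rw [ec] at hpc
  have e : trans θ hθ hθc hc2 a (a + 1) b₁ + wplus θ hθ hθc hc2 (a + 1) =
      ((Finsupp.single (oflipCM c hc2 (θ.symm (a + 1, b₁)) (cst θ hθ hθc a)) 1 - Finsupp.single (cst θ hθ hθc a) 1)
        - (Finsupp.single (catom θ hθ hθc hc2 (a + 1 - n) b₂) 1 - Finsupp.single (cst θ hθ hθc (a - ((n - 2 : ℕ) : ℕ))) 1))
      + (Finsupp.single (catom θ hθ hθc hc2 (a + 1 - n) b₂) 1 + Finsupp.single (catom θ hθ hθc hc2 (a + 1) b₂) 1)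
      - (Finsupp.single (cst θ hθ hθc (a - ((n - 2 : ℕ) : ℕ))) 1 + Finsupp.single (cst θ hθ hθc (a + 1 + 1)) 1) := by
    rw [trans, wplus, sum_eq_add_of_two h12 huniv, card_eq_two_of_two h12 huniv, catom]
    push_cast
    rw [one_smul]
    abel
  rw [e]
  exact Submodule.sub_mem _ (Submodule.add_mem _ hchain (hP hpa)) (hP hpc)

end TwoCol

end

end Summit.HodgeConjecture.CorCM.Census.TwistGeneration
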